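import Mathlib
import Summits.NavierStokesRegularity.NavierStokesRegularity.Theorems.QuarterLogPincerSmoothSilenceKernel
import Summits.NavierStokesRegularity.NavierStokesRegularity.Theorems.QuarterLogPincerSmoothSilenceNormalisation
import HarnessLib

/-!
# Line `smooth_silence`: the smooth failing family is EXACTLY the negation of Sc″ (kernel fact) — refuter lane ns-afl-r1

Supports crux stmt-NavierStokesRegularity-24077 (`QuarterLogPincer.TypeIQuantSubcubicExp`) via ns-idea-7's line
`Cruxes/TypeIQuantSubcubicExp/Lines/smooth_silence.lean` (v1.2, sha16 d18f6cfda9fbc9d1), whose vocabulary is in the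
tree BY NAME (`…Theorems.QuarterLogPincerSmoothSilenceDefs`: `DriftStretchBox`, `DriftStretchSilencingCost` = Sc″,
`SmoothFailingFamily`, `SmoothNormalisation`; pub-ns-dss typer g38) together with the PROVED normalisation step L♯1
`SmoothSilence.stub_smoothNormalisation : ¬ DriftStretchSilencingCost → SmoothFailingFamily`
(`…Theorems.QuarterLogPincerSmoothSilenceNormalisation`).  NO Theses decl is asserted; nothing about the crux,
about Sc″ or about the open stub L♯2 `SmoothLimitStep` is proved or refuted (HONEST FRAME: 24077, W7 and
Navier–Stokes regularity are OPEN).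

* `not_driftStretchSilencingCost_of_smoothFailingFamily : SmoothFailingFamily → ¬ DriftStretchSilencingCost` — the
  converse of L♯1 (member `n` at `σ = 1`, `y = 0`, `t = 0`, `t₁ = s₁`, with `Γ₂ + n ≥ K`, `1/(n+1) ≤ c`).
* `smoothFailingFamily_iff_not_driftStretchSilencingCost : SmoothFailingFamily ↔ ¬ DriftStretchSilencingCost` —
  with the line's PROVED exclusion `SmoothSilence.no_smoothVanishingWitness`, the compactness stub L♯2
  `SmoothLimitStep : SmoothFailingFamily → SmoothVanishingWitness` is therefore EQUIVALENT to Sc″ itself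
  (`smoothLimitStep_iff_driftStretchSilencingCost`): L♯2 carries the whole content of the silencing cost in the
  drift–stretch class — it is refutable exactly if Sc″ is, and by the same witness.
-/

-- the summit and its single sub-problem share the name (CONVENTIONS §1), as in every Theorems file
set_option linter.dupNamespace false

namespace Summit.NavierStokesRegularity.NavierStokesRegularity.Theorems.TypeIQuantSubcubicExp.Negative.SmoothSilence

noncomputable section

open MeasureTheory Set Metric
open Summit.NavierStokesRegularity.NavierStokesRegularity.Cruxes.TypeIQuantSubcubicExp.SmoothSilence
  (DriftStretchBox DriftStretchSilencingCost SmoothFailingFamily SmoothLimitStep SmoothVanishingWitness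
    stub_smoothNormalisation no_smoothVanishingWitness)

/-- The drift–stretch box is monotone in the radius. -/
theorem driftStretchBox_mono_radius {B γ σ : ℝ}
    {ω v : ℝ → (EuclideanSpace ℝ (Fin 3)) → (EuclideanSpace ℝ (Fin 3))} {y : EuclideanSpace ℝ (Fin 3)}
    {S : Set ℝ} {ρ ρ' : ℝ} (h : DriftStretchBox B γ σ ω v y S ρ) (hρ : ρ' ≤ ρ) :
    DriftStretchBox B γ σ ω v y S ρ' :=
  ⟨h.1, h.2.1, fun s hs x hx => h.2.2 s hs x (ball_subset_ball hρ hx)⟩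

/-- **The converse of L♯1**: a normalised smooth failing family refutes Sc″ `DriftStretchSilencingCost`. -/
theorem not_driftStretchSilencingCost_of_smoothFailingFamily (h : SmoothFailingFamily) :
    ¬ DriftStretchSilencingCost := by
  intro hS
  obtain ⟨B, γ, δ, Γ₂, hB, hγ, hδ, hΓ₂, hfam⟩ := h
  obtain ⟨K, c, hK, hc, -, H⟩ := hS B γ δ Γ₂ hB hγ hδ hΓ₂
  -- an index `n` with `K ≤ Γ₂ + n` and `1/(n+1) ≤ c`
  obtain ⟨n, hn⟩ := exists_nat_ge (max K (1 / c))
  have hnK : K ≤ Γ₂ + n := by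
    have : K ≤ (n : ℝ) := (le_max_left _ _).trans hn
    linarith
  have hnc : 1 / ((n : ℝ) + 1) ≤ c := by
    have h1 : 1 / c ≤ (n : ℝ) := (le_max_right _ _).trans hn
    have h2 : 1 ≤ c * n := by
      have := mul_le_mul_of_nonneg_left h1 hc.le
      rwa [mul_one_div_cancel hc.ne'] at this
    rw [div_le_iff₀ (by positivity)]
    nlinarith
  obtain ⟨ω, v, s₁, hs₁, hs₁1, hbox, hinit, hfinal⟩ := hfam n
  have hbox' : DriftStretchBox B γ 1 ω v 0 (Icc 0 s₁) (2 * K * 1) :=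
    driftStretchBox_mono_radius hbox (by nlinarith)
  have hinit' : ENNReal.ofReal (δ / 1) ≤
      ∫⁻ x in ball (0 : EuclideanSpace ℝ (Fin 3)) (Γ₂ * 1), ‖ω 0 x‖ₑ ^ 2 := by
    simpa only [div_one, mul_one] using hinit
  have key := H ω v 0 1 0 s₁ one_pos hs₁ (by simpa only [one_pow, zero_add] using hs₁1) hbox' hinit'
  have hmono : ∫⁻ x in ball (0 : EuclideanSpace ℝ (Fin 3)) (K * 1), ‖ω s₁ x‖ₑ ^ 2 ≤
      ∫⁻ x in ball (0 : EuclideanSpace ℝ (Fin 3)) (Γ₂ + n), ‖ω s₁ x‖ₑ ^ 2 :=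
    lintegral_mono_set (ball_subset_ball (by simpa only [mul_one] using hnK))
  have hlt : ENNReal.ofReal c < ENNReal.ofReal (1 / ((n : ℝ) + 1)) := by
    have hk : ENNReal.ofReal c ≤ ∫⁻ x in ball (0 : EuclideanSpace ℝ (Fin 3)) (K * 1), ‖ω s₁ x‖ₑ ^ 2 := by
      simpa only [div_one] using key
    exact lt_of_le_of_lt (hk.trans hmono) hfinal
  rw [ENNReal.ofReal_lt_ofReal_iff (by positivity)] at hlt
  linarith

/-- **Sc″'s failure IS a normalised smooth failing family** (L♯1 by name + its converse). -/
theorem smoothFailingFamily_iff_not_driftStretchSilencingCost :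
    SmoothFailingFamily ↔ ¬ DriftStretchSilencingCost :=
  ⟨not_driftStretchSilencingCost_of_smoothFailingFamily, stub_smoothNormalisation⟩

/-- **L♯2 is equivalent to Sc″** (given the line's PROVED L♯1 and PROVED exclusion of smooth vanishing
witnesses): the compactness stub carries the entire content of the drift–stretch silencing cost. -/
theorem smoothLimitStep_iff_driftStretchSilencingCost : SmoothLimitStep ↔ DriftStretchSilencingCost := by
  constructor
  · intro h₂
    by_contra h
    exact no_smoothVanishingWitness (h₂ (stub_smoothNormalisation h))
  · intro hS hfam
    exact absurd hS (not_driftStretchSilencingCost_of_smoothFailingFamily hfam)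

end

end Summit.NavierStokesRegularity.NavierStokesRegularity.Theorems.TypeIQuantSubcubicExp.Negative.SmoothSilence
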